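import Literature.Analysis.FluidPDE.TorusVorticityMomentLadder
import HarnessLib

/-!
# Gibbon's vorticity-moment ladder on `𝕋³`, FORCED case: the `Ωₘ` and `Dₘ` forms
(Gibbon 2012, Thm 2: "In the forced case there is an additive term `ϖ_{3,m}Gr Dₘ`")

Analysis/FluidPDE proof file (theorems only; no definitions, no named facts). Search for
candidate a priori estimates; no regularity claim (cell `pub-nsfunc`, literature seat: this file
formalises a PUBLISHED argument, nothing new).

Companion of `TorusVorticityMomentLadder.lean` (which stops, for size, at the forced `Jₘ`-form
`exists_vorticityMoment_ladder_forced`, its §12). Here the forcing is carried through the change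
of variables `Jₘ ↦ Ωₘ ↦ Dₘ` exactly as in the unforced §6 of that file:

* `exists_gibbonOmega_ladder_forced`: along a classical solution of the forced system (`ν > 0`),
  at every instant at which the forcing slice `f t` is smooth, every one-sided derivative value
  `R` of `s ↦ Ωₘ(u(s))` obeys the unforced bound ((5.17)–(5.18)) plus `(∫|curl f(t)|^{2m})^{1/2m}`
  (because `2mΩₘ^{2m−1}Ω̇ₘ = J̇ₘ` and `Jₘ^{(2m−1)/2m} ≤ Ωₘ^{2m−1}`);
* `exists_gibbonD_ladder_forced`: **THEOREM 2, forced case** —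
  `R ≤ Dₘ³{−νc₁(D_{m+1}/Dₘ)^{ρₘ} + νc₂} + c₃ Dₘ (∫|curl f(t)|^{2m})^{1/2m}/ν`, the generic-forcing
  shape of the printed additive term (`αₘDₘ‖curl f‖_{2m}/Ωₘ ≤ αₘDₘ‖curl f‖_{2m}/ν`).

DEVIATIONS FROM PRINT (for the referee): as in the companion file (classical solutions on a window
`[a, b]` with one-sided derivatives; unit torus, `ϖ₀ = ν`; natural `m ≥ 1`; power-mean
regularised `Ωₘ`; constants existential), plus: the forcing is an arbitrary field `f` whose slice
`f t` is smooth at the instant considered, entering through `‖curl f(t)‖_{L^{2m}}` in the tree's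
normalisation `(∫ (torusVorticitySqAt (f t))^m)^{1/2m}`; the print's packaging of this term as
`ϖ_{3,m} Gr Dₘ` (Grashof number, single-scale forcing bound (5.8)) is NOT typed. The proofs are
the unforced ones of the companion file with the forcing term carried along.

A priori differential inequalities along smooth solutions only. Nothing here is a regularity
statement.

## References

* [Gibbon2012JMP] J. D. Gibbon, *Conditional regularity of solutions of the three-dimensional
  Navier–Stokes equations and implications for intermittency*, J. Math. Phys. 53 (2012) 115608
  (arXiv:1108.4651): Thm 2 (forced case), §5 (5.6)–(5.8), (5.15)–(5.20).
-/

noncomputable section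

open Set MeasureTheory Finset Filter Topology
open scoped ContDiff InnerProductSpace RealInnerProductSpace

namespace Literature.Analysis.FluidPDE

open Literature.Analysis.FunctionSpaces

namespace VorticityMomentLadder

variable {d : Type*} [Fintype d] [DecidableEq d]

omit [Fintype d] [DecidableEq d] in
/-- `(xⁿ)ʳ = x^{n r}` for `x ≥ 0` (natural `n`, real `r`). [folklore] -/
private theorem pow_rpow_eq_rpow_mul {x : ℝ} (hx : 0 ≤ x) (n : ℕ) (r : ℝ) :
    (x ^ n) ^ r = x ^ ((n : ℝ) * r) := by
  rw [← Real.rpow_natCast, ← Real.rpow_mul hx]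

/-- `∫|ω|^{2m} ≥ 0`. [folklore] -/
private theorem integral_pow_nonneg (v : UnitAddTorus d → EuclideanSpace ℝ d) (n : ℕ) :
    0 ≤ ∫ x, torusVorticitySqAt v x ^ n :=
  integral_nonneg fun x => pow_nonneg (torusVorticitySqAt_nonneg v x) _

omit [Fintype d] [DecidableEq d] in
/-- `(x + y)ᵖ ≤ 2ᵖ (xᵖ + yᵖ)` for `x, y, p ≥ 0`. [folklore] -/
private theorem add_rpow_le_two_rpow_mul {x y p : ℝ} (hx : 0 ≤ x) (hy : 0 ≤ y) (hp : 0 ≤ p) :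
    (x + y) ^ p ≤ (2 : ℝ) ^ p * (x ^ p + y ^ p) := by
  have h1 : x + y ≤ 2 * max x y := by
    rcases le_total x y with h | h
    · rw [max_eq_right h]; linarith
    · rw [max_eq_left h]; linarith
  have h2 : (x + y) ^ p ≤ (2 * max x y) ^ p := Real.rpow_le_rpow (add_nonneg hx hy) h1 hp
  have h3 : (max x y) ^ p ≤ x ^ p + y ^ p := by
    rcases le_total x y with h | h
    · rw [max_eq_right h]; linarith [Real.rpow_nonneg hx p]
    · rw [max_eq_left h]; linarith [Real.rpow_nonneg hy p]
  calc (x + y) ^ p ≤ (2 * max x y) ^ p := h2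
    _ = (2 : ℝ) ^ p * (max x y) ^ p := Real.mul_rpow (by norm_num) (le_max_of_le_left hx)
    _ ≤ (2 : ℝ) ^ p * (x ^ p + y ^ p) :=
        mul_le_mul_of_nonneg_left h3 (Real.rpow_nonneg (by norm_num) _)

end VorticityMomentLadder

open VorticityMomentLadder in
/-- **The forced `Ωₘ` ladder** (Gibbon 2012, §5 (5.15)–(5.18) with the forcing kept as
`‖curl f‖_{2m}`): along a classical solution of the FORCED system (`ν > 0`), at every instant at
which the forcing slice `f t` is smooth, every one-sided derivative value `R` of `s ↦ Ωₘ(u(s))`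
within `[a, b]` obeys the unforced bound of `exists_gibbonOmega_ladder` plus
`(∫|curl f(t)|^{2m})^{1/2m}` (from `exists_vorticityMoment_ladder_forced` through
`2mΩₘ^{2m−1}Ω̇ₘ = J̇ₘ` and `Jₘ^{(2m−1)/2m} ≤ Ωₘ^{2m−1}`; the print's `c_{3,m}ϖ₀²Ωₘ^{2m−1}Gr` in
(5.15) and `c_{6,m}ϖ₀`/`c_{3,m}` in (5.17)–(5.18) come from its single-scale forcing bound (5.8),
not typed). [cite: Gibbon2012JMP, §5 eqs. (5.15)–(5.18)] -/
theorem exists_gibbonOmega_ladder_forced (m : ℕ) (hm : 1 ≤ m) :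
    ∃ k₁ k₂ k₃ : ℝ, 0 < k₁ ∧ 0 ≤ k₂ ∧ 0 ≤ k₃ ∧
      ∀ {a b ν : ℝ} {f u : ℝ → UnitAddTorus (Fin 3) → EuclideanSpace ℝ (Fin 3)}
        {p : ℝ → UnitAddTorus (Fin 3) → ℝ},
        Torus.IsClassicalNSSolutionOn (Icc a b) ν f u p → a < b → 0 < ν →
        ∀ {t : ℝ}, t ∈ Icc a b → Torus.IsSmooth (f t) → ∀ {R : ℝ},
          HasDerivWithinAt (fun s => gibbonOmega ν m (u s)) R (Icc a b) t →
          R ≤ ν * gibbonOmega ν m (u t) *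
            (-(k₁ * (gibbonOmega ν (m + 1) (u t) / gibbonOmega ν m (u t)) ^
                (4 * (m : ℝ) * (m + 1) / 3)) +
              k₂ * (gibbonOmega ν m (u t) / ν) ^ (2 * gibbonAlpha m) + k₃) +
            (∫ x, torusVorticitySqAt (f t) x ^ m) ^ ((1 : ℝ) / (2 * m)) := by
  obtain ⟨c₁, c₂, c₃, hc₁, hc₂, hc₃, hlad⟩ := exists_vorticityMoment_ladder_forced m hm
  have hm0 : (0 : ℝ) < m := by exact_mod_cast hm
  have hm1 : (1 : ℝ) ≤ m := by exact_mod_cast hm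
  -- exponents
  set pe : ℝ := 2 * (m : ℝ) / 3 with hpe
  set qe : ℝ := (2 * (m : ℝ) - 1) / 3 with hqe
  set β : ℝ := 4 * (m : ℝ) * (m + 1) / 3 with hβ
  set θ : ℝ := 3 / (4 * (m : ℝ)) with hθ
  set P : ℝ := 4 * (m : ℝ) / 3 with hP
  set Q : ℝ := 4 * (m : ℝ) / (4 * m - 3) with hQ
  have hpe0 : 0 ≤ pe := by positivity
  have hqe0 : 0 ≤ qe := by rw [hqe]; linarith
  have hβ0 : 0 < β := by positivity
  have hθ0 : 0 < θ := by positivity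
  have h4m3 : (0 : ℝ) < 4 * m - 3 := by linarith
  have hP0 : 0 < P := by positivity
  have hQ0 : 0 < Q := by positivity
  have hPQ : P.HolderConjugate Q :=
    { inv_add_inv_eq_inv := by
        rw [hP, hQ, inv_one, inv_div, inv_div, ← add_div]; field_simp; ring
      left_pos := hP0
      right_pos := hQ0 }
  have hθP : θ * P = 1 := by rw [hθ, hP]; field_simp
  have hθQ : θ * Q = Q - 1 := by rw [hθ, hQ]; field_simp; ring
  have hQα : Q = 2 * gibbonAlpha m := by rw [hQ, gibbonAlpha]; ring
  have hβθ : β * θ = (m : ℝ) + 1 := by rw [hβ, hθ]; field_simp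
  -- constants
  set k₁' : ℝ := c₁ * (2 : ℝ) ^ (-pe) / (2 * m) with hk₁'
  set k₅ : ℝ := c₃ / (2 * m) with hk₅
  set k₆ : ℝ := (c₁ + c₂) / (2 * m) with hk₆
  have hk₁'0 : 0 < k₁' := by positivity
  have hk₅0 : 0 ≤ k₅ := by positivity
  have hk₆0 : 0 ≤ k₆ := by positivity
  set k₂ : ℝ := k₅ ^ Q * (P * k₁' / 2) ^ (-(Q - 1)) / Q with hk₂
  have hk₂0 : 0 ≤ k₂ := by positivity
  refine ⟨k₁' / 2, k₂, k₆, by positivity, hk₂0, hk₆0, ?_⟩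
  intro a b ν f u p h hab hν t ht hft R hR
  -- Young's inequality in the form used for the central term of (5.17)
  have young : ∀ {Y Ω : ℝ}, 0 ≤ Y → 0 < Ω →
      k₅ * Y ^ θ * Ω ≤ ν * k₁' / 2 * Y + k₂ * (ν * (Ω / ν) ^ Q) := by
    intro Y Ω hY hΩ
    set x : ℝ := P * ν * k₁' / 2 with hx
    have hx0 : 0 < x := by positivity
    set a' : ℝ := x ^ θ * Y ^ θ with ha'
    set b' : ℝ := k₅ * Ω * x ^ (-θ) with hb'
    have ha'0 : 0 ≤ a' := by positivity
    have hb'0 : 0 ≤ b' := by positivity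
    have hY' := Real.young_inequality_of_nonneg ha'0 hb'0 hPQ
    have eab : a' * b' = k₅ * Y ^ θ * Ω := by
      rw [ha', hb', Real.rpow_neg hx0.le]
      field_simp
    have eaP : a' ^ P / P = ν * k₁' / 2 * Y := by
      rw [ha', Real.mul_rpow (Real.rpow_nonneg hx0.le _) (Real.rpow_nonneg hY _),
        ← Real.rpow_mul hx0.le, ← Real.rpow_mul hY, hθP, Real.rpow_one, Real.rpow_one, hx]
      field_simp
    have ebQ : b' ^ Q / Q = k₂ * (ν * (Ω / ν) ^ Q) := by
      rw [hb', Real.mul_rpow (mul_nonneg hk₅0 hΩ.le) (Real.rpow_nonneg hx0.le _),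
        Real.mul_rpow hk₅0 hΩ.le, ← Real.rpow_mul hx0.le, neg_mul, hθQ, hk₂, hx,
        Real.div_rpow hΩ.le hν.le]
      have hνQ : ν ^ Q = ν * ν ^ (Q - 1) := by
        rw [Real.rpow_sub_one hν.ne']; field_simp
      have e1 : (P * ν * k₁' / 2) ^ (-(Q - 1)) = (P * k₁' / 2) ^ (-(Q - 1)) * ν ^ (-(Q - 1)) := by
        rw [show P * ν * k₁' / 2 = (P * k₁' / 2) * ν by ring,
          Real.mul_rpow (by positivity) hν.le]
      rw [e1, hνQ, Real.rpow_neg hν.le (Q - 1)]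
      have hνQ1 : 0 < ν ^ (Q - 1) := Real.rpow_pos_of_pos hν _
      field_simp
    rw [eab, eaP, ebQ] at hY'
    exact hY'
  -- the objects at time `t`
  have hut : Torus.IsSmooth (u t) := h.smooth_velocity.isSmooth_slice ht
  set Ω : ℝ := gibbonOmega ν m (u t) with hΩdef
  set Ωp : ℝ := gibbonOmega ν (m + 1) (u t) with hΩpdef
  set J : ℝ := ∫ x, torusVorticitySqAt (u t) x ^ m with hJdef
  set Jp : ℝ := ∫ x, torusVorticitySqAt (u t) x ^ (m + 1) with hJpdef
  set J3 : ℝ := (∫ x, torusVorticitySqAt (u t) x ^ (3 * m)) ^ ((1 : ℝ) / 3) with hJ3def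
  have hΩ : 0 < Ω := gibbonOmega_pos hν hm (u t)
  have hΩp : 0 < Ωp := gibbonOmega_pos hν (by omega) (u t)
  have hνΩ : ν ≤ Ω := le_gibbonOmega hν hm (u t)
  have hJ0 : 0 ≤ J := integral_pow_nonneg (u t) m
  have hJp0 : 0 ≤ Jp := integral_pow_nonneg (u t) (m + 1)
  have hJ30 : 0 ≤ J3 := Real.rpow_nonneg (integral_pow_nonneg (u t) (3 * m)) _
  have hJΩ : J ≤ Ω ^ (2 * m) := integral_pow_le_gibbonOmega_pow hν.le hm (u t)
  have hΩppow : Ωp ^ (2 * (m + 1)) = Jp + ν ^ (2 * (m + 1)) := gibbonOmega_pow hν.le (by omega) (u t)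
  -- the `J`-derivative and the chain rule
  have hD := h.hasDerivWithinAt_integral_torusVorticitySqAt_pow hab m ht
  set V : ℝ := (2 * m * (∫ x, torusVorticitySqAt (u t) x ^ (m - 1) * torusStretchingDensity (u t) x) -
        ν * (m * (∫ x, torusVorticitySqAt (u t) x ^ (m - 1) * ∑ k, ∑ i, ∑ j,
              Torus.partialDeriv k (torusVorticityTensor (u t) i j) x ^ 2) +
            m * (m - 1) * ∫ x, torusVorticitySqAt (u t) x ^ (m - 2) *
              ∑ k, Torus.partialDeriv k (torusVorticitySqAt (u t)) x ^ 2) +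
        m * ∫ x, torusVorticitySqAt (u t) x ^ (m - 1) * ∑ i, ∑ j, torusVorticityTensor (u t) i j x *
          (Torus.partialDeriv i (f t) x j - Torus.partialDeriv j (f t) x i))
    with hVdef
  set F : ℝ := ∫ x, torusVorticitySqAt (f t) x ^ m with hFdef
  have hF0 : 0 ≤ F := integral_pow_nonneg (f t) m
  have hVlad : V ≤ -(ν * c₁ * J3) + ν * c₂ * J + c₃ * Real.sqrt J * Real.sqrt Jp +
      2 * m * J ^ ((2 * (m : ℝ) - 1) / (2 * m)) * F ^ ((1 : ℝ) / (2 * m)) :=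
    hlad h hab hν.le ht hft hD
  have hΩ' := hasDerivWithinAt_gibbonOmega hν hm hD
  have hU : UniqueDiffWithinAt ℝ (Icc a b) t := uniqueDiffOn_Icc hab t ht
  have hReq : R = 1 / (2 * m) * Ω ^ ((1 : ℝ) - 2 * m) * V :=
    (hR.derivWithin hU).symm.trans (hΩ'.derivWithin hU)
  set cf : ℝ := 1 / (2 * m) * Ω ^ ((1 : ℝ) - 2 * m) with hcfdef
  have hcf0 : 0 < cf := by positivity
  -- `Ω^{1-2m} Ω^{2m} = Ω`, `Ω^{1-2m} Ω^m = Ω^{1-m}`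
  have eΩ1 : Ω ^ ((1 : ℝ) - 2 * m) * Ω ^ (2 * m) = Ω := by
    rw [← Real.rpow_natCast Ω (2 * m), ← Real.rpow_add hΩ]
    push_cast
    simp
  have eΩ2 : Ω ^ ((1 : ℝ) - 2 * m) * Ω ^ m = Ω ^ ((1 : ℝ) - m) := by
    rw [← Real.rpow_natCast Ω m, ← Real.rpow_add hΩ]
    congr 1
    ring
  -- Step A: `Ωp^β ≤ 2^pe Ω^{2m qe} (J3 + ν^{2m})`
  have hA : Ωp ^ β ≤ (2 : ℝ) ^ pe * Ω ^ (2 * (m : ℝ) * qe) * (J3 + ν ^ (2 * m)) := by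
    have e1 : Ωp ^ β = (Jp + ν ^ (2 * (m + 1))) ^ pe := by
      rw [← hΩppow, pow_rpow_eq_rpow_mul hΩp.le]
      congr 1
      rw [hβ, hpe]; push_cast; ring
    have h2 : (Jp + ν ^ (2 * (m + 1))) ^ pe ≤ (2 : ℝ) ^ pe * (Jp ^ pe + (ν ^ (2 * (m + 1))) ^ pe) :=
      add_rpow_le_two_rpow_mul hJp0 (pow_nonneg hν.le _) hpe0
    have h3 : Jp ^ pe ≤ Ω ^ (2 * (m : ℝ) * qe) * J3 := by
      have hint := integral_pow_succ_rpow_le_interpolation hm hut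
      have e2 : (2 * (m : ℝ) - 1) / 3 = qe := by rw [hqe]
      have e3 : 2 * (m : ℝ) / 3 = pe := by rw [hpe]
      rw [e2, e3] at hint
      have h4 : J ^ qe ≤ Ω ^ (2 * (m : ℝ) * qe) := by
        calc J ^ qe ≤ (Ω ^ (2 * m)) ^ qe := Real.rpow_le_rpow hJ0 hJΩ hqe0
          _ = Ω ^ (2 * (m : ℝ) * qe) := by
              rw [pow_rpow_eq_rpow_mul hΩ.le]; push_cast; ring_nf
      calc Jp ^ pe ≤ J ^ qe * J3 := hint
        _ ≤ Ω ^ (2 * (m : ℝ) * qe) * J3 := mul_le_mul_of_nonneg_right h4 hJ30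
    have h5 : (ν ^ (2 * (m + 1))) ^ pe ≤ Ω ^ (2 * (m : ℝ) * qe) * ν ^ (2 * m) := by
      have e4 : (ν ^ (2 * (m + 1))) ^ pe = ν ^ (2 * (m : ℝ) * qe) * ν ^ (2 * m) := by
        rw [pow_rpow_eq_rpow_mul hν.le, ← Real.rpow_natCast ν (2 * m), ← Real.rpow_add hν]
        congr 1
        rw [hpe, hqe]; push_cast; ring
      rw [e4]
      exact mul_le_mul_of_nonneg_right (Real.rpow_le_rpow hν.le hνΩ (by positivity))
        (pow_nonneg hν.le _)
    calc Ωp ^ β = (Jp + ν ^ (2 * (m + 1))) ^ pe := e1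
      _ ≤ (2 : ℝ) ^ pe * (Jp ^ pe + (ν ^ (2 * (m + 1))) ^ pe) := h2
      _ ≤ (2 : ℝ) ^ pe * (Ω ^ (2 * (m : ℝ) * qe) * J3 + Ω ^ (2 * (m : ℝ) * qe) * ν ^ (2 * m)) := by
          gcongr
      _ = (2 : ℝ) ^ pe * Ω ^ (2 * (m : ℝ) * qe) * (J3 + ν ^ (2 * m)) := by ring
  -- Step B: the dissipative term
  have hB : cf * -(ν * c₁ * J3) ≤ -(ν * k₁' * (Ωp ^ β * Ω ^ (1 - β))) + ν * (c₁ / (2 * m)) * Ω := by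
    -- `2^{-pe} Ωp^β Ω^{1-β} ≤ Ω^{1-2m} (J3 + ν^{2m})`
    have e5 : Ω ^ (2 * (m : ℝ) * qe) * Ω ^ (1 - β) = Ω ^ ((1 : ℝ) - 2 * m) := by
      rw [← Real.rpow_add hΩ]
      congr 1
      rw [hqe, hβ]; ring
    have h6 : (2 : ℝ) ^ (-pe) * (Ωp ^ β * Ω ^ (1 - β)) ≤
        Ω ^ ((1 : ℝ) - 2 * m) * (J3 + ν ^ (2 * m)) := by
      have h7 := mul_le_mul_of_nonneg_right hA (Real.rpow_nonneg hΩ.le (1 - β))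
      have h8 : (2 : ℝ) ^ (-pe) * ((2 : ℝ) ^ pe * Ω ^ (2 * (m : ℝ) * qe) * (J3 + ν ^ (2 * m)) *
          Ω ^ (1 - β)) = Ω ^ ((1 : ℝ) - 2 * m) * (J3 + ν ^ (2 * m)) := by
        rw [← e5, Real.rpow_neg (by norm_num : (0 : ℝ) ≤ 2)]
        have : (2 : ℝ) ^ pe ≠ 0 := (Real.rpow_pos_of_pos (by norm_num) _).ne'
        field_simp
      calc (2 : ℝ) ^ (-pe) * (Ωp ^ β * Ω ^ (1 - β))
          = (2 : ℝ) ^ (-pe) * (Ωp ^ β * Ω ^ (1 - β)) := rfl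
        _ ≤ (2 : ℝ) ^ (-pe) * ((2 : ℝ) ^ pe * Ω ^ (2 * (m : ℝ) * qe) * (J3 + ν ^ (2 * m)) *
              Ω ^ (1 - β)) :=
            mul_le_mul_of_nonneg_left h7 (Real.rpow_nonneg (by norm_num) _)
        _ = Ω ^ ((1 : ℝ) - 2 * m) * (J3 + ν ^ (2 * m)) := h8
    -- `Ω^{1-2m} ν^{2m} ≤ Ω`
    have h9 : Ω ^ ((1 : ℝ) - 2 * m) * ν ^ (2 * m) ≤ Ω := by
      calc Ω ^ ((1 : ℝ) - 2 * m) * ν ^ (2 * m) ≤ Ω ^ ((1 : ℝ) - 2 * m) * Ω ^ (2 * m) :=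
            mul_le_mul_of_nonneg_left (pow_le_pow_left₀ hν.le hνΩ _) (Real.rpow_nonneg hΩ.le _)
        _ = Ω := eΩ1
    have h10 : ν * k₁' * (Ωp ^ β * Ω ^ (1 - β)) =
        ν * (c₁ / (2 * m)) * ((2 : ℝ) ^ (-pe) * (Ωp ^ β * Ω ^ (1 - β))) := by
      rw [hk₁']; ring
    rw [h10, hcfdef]
    have h11 : ν * (c₁ / (2 * m)) * ((2 : ℝ) ^ (-pe) * (Ωp ^ β * Ω ^ (1 - β))) ≤
        ν * (c₁ / (2 * m)) * (Ω ^ ((1 : ℝ) - 2 * m) * (J3 + ν ^ (2 * m))) :=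
      mul_le_mul_of_nonneg_left h6 (by positivity)
    have h12 : ν * (c₁ / (2 * m)) * (Ω ^ ((1 : ℝ) - 2 * m) * ν ^ (2 * m)) ≤
        ν * (c₁ / (2 * m)) * Ω := mul_le_mul_of_nonneg_left h9 (by positivity)
    have e13 : ν * (c₁ / (2 * m)) * (Ω ^ ((1 : ℝ) - 2 * m) * (J3 + ν ^ (2 * m))) =
        -(1 / (2 * m) * Ω ^ ((1 : ℝ) - 2 * m) * -(ν * c₁ * J3)) +
          ν * (c₁ / (2 * m)) * (Ω ^ ((1 : ℝ) - 2 * m) * ν ^ (2 * m)) := by ring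
    rw [e13] at h11
    linarith
  -- Step C: the `c₂` term
  have hC : cf * (ν * c₂ * J) ≤ ν * (c₂ / (2 * m)) * Ω := by
    rw [hcfdef]
    have : Ω ^ ((1 : ℝ) - 2 * m) * J ≤ Ω := by
      calc Ω ^ ((1 : ℝ) - 2 * m) * J ≤ Ω ^ ((1 : ℝ) - 2 * m) * Ω ^ (2 * m) :=
            mul_le_mul_of_nonneg_left hJΩ (Real.rpow_nonneg hΩ.le _)
        _ = Ω := eΩ1
    have h' := mul_le_mul_of_nonneg_left this (by positivity : 0 ≤ ν * c₂ / (2 * m))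
    calc 1 / (2 * m) * Ω ^ ((1 : ℝ) - 2 * m) * (ν * c₂ * J)
        = ν * c₂ / (2 * m) * (Ω ^ ((1 : ℝ) - 2 * m) * J) := by ring
      _ ≤ ν * c₂ / (2 * m) * Ω := h'
      _ = ν * (c₂ / (2 * m)) * Ω := by ring
  -- Step D: the stretching term
  have hDst : cf * (c₃ * Real.sqrt J * Real.sqrt Jp) ≤ k₅ * (Ωp ^ ((m : ℝ) + 1) * Ω ^ ((1 : ℝ) - m)) := by
    have h1 : Real.sqrt J ≤ Ω ^ m := sqrt_integral_pow_le_gibbonOmega_pow hν hm (u t)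
    have h2 : Real.sqrt Jp ≤ Ωp ^ (m + 1) := sqrt_integral_pow_le_gibbonOmega_pow hν (by omega) (u t)
    have h3 : Real.sqrt J * Real.sqrt Jp ≤ Ω ^ m * Ωp ^ (m + 1) :=
      mul_le_mul h1 h2 (Real.sqrt_nonneg _) (pow_nonneg hΩ.le _)
    have h4 := mul_le_mul_of_nonneg_left h3 (by positivity : 0 ≤ cf * c₃)
    have e : cf * c₃ * (Ω ^ m * Ωp ^ (m + 1)) = k₅ * (Ωp ^ ((m : ℝ) + 1) * Ω ^ ((1 : ℝ) - m)) := by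
      rw [hcfdef, hk₅, ← eΩ2, ← Real.rpow_natCast Ωp (m + 1)]
      push_cast
      ring
    calc cf * (c₃ * Real.sqrt J * Real.sqrt Jp) = cf * c₃ * (Real.sqrt J * Real.sqrt Jp) := by ring
      _ ≤ cf * c₃ * (Ω ^ m * Ωp ^ (m + 1)) := h4
      _ = k₅ * (Ωp ^ ((m : ℝ) + 1) * Ω ^ ((1 : ℝ) - m)) := e
  -- Step E: the forcing term, `cf · 2m Jₘ^{(2m−1)/2m} F^{1/2m} ≤ F^{1/2m}`
  have hE : cf * (2 * m * J ^ ((2 * (m : ℝ) - 1) / (2 * m)) * F ^ ((1 : ℝ) / (2 * m))) ≤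
      F ^ ((1 : ℝ) / (2 * m)) := by
    have hF1 : 0 ≤ F ^ ((1 : ℝ) / (2 * m)) := Real.rpow_nonneg hF0 _
    have hq0 : 0 ≤ (2 * (m : ℝ) - 1) / (2 * m) := div_nonneg (by linarith) (by positivity)
    have h1 : J ^ ((2 * (m : ℝ) - 1) / (2 * m)) ≤ Ω ^ (2 * (m : ℝ) - 1) := by
      calc J ^ ((2 * (m : ℝ) - 1) / (2 * m)) ≤ (Ω ^ (2 * m)) ^ ((2 * (m : ℝ) - 1) / (2 * m)) :=
            Real.rpow_le_rpow hJ0 hJΩ hq0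
        _ = Ω ^ (2 * (m : ℝ) - 1) := by
            rw [pow_rpow_eq_rpow_mul hΩ.le]
            congr 1
            push_cast
            rw [mul_div_assoc', div_eq_iff (by positivity : (2 : ℝ) * m ≠ 0)]
            ring
    have e1 : cf * (2 * m * J ^ ((2 * (m : ℝ) - 1) / (2 * m)) * F ^ ((1 : ℝ) / (2 * m))) =
        Ω ^ ((1 : ℝ) - 2 * m) * J ^ ((2 * (m : ℝ) - 1) / (2 * m)) * F ^ ((1 : ℝ) / (2 * m)) := by
      rw [hcfdef]
      have : (2 : ℝ) * m ≠ 0 := by positivity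
      field_simp
    have e2 : Ω ^ ((1 : ℝ) - 2 * m) * Ω ^ (2 * (m : ℝ) - 1) = 1 := by
      rw [← Real.rpow_add hΩ, show (1 : ℝ) - 2 * m + (2 * m - 1) = 0 by ring, Real.rpow_zero]
    rw [e1]
    calc Ω ^ ((1 : ℝ) - 2 * m) * J ^ ((2 * (m : ℝ) - 1) / (2 * m)) * F ^ ((1 : ℝ) / (2 * m))
        ≤ Ω ^ ((1 : ℝ) - 2 * m) * Ω ^ (2 * (m : ℝ) - 1) * F ^ ((1 : ℝ) / (2 * m)) :=
          mul_le_mul_of_nonneg_right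
            (mul_le_mul_of_nonneg_left h1 (Real.rpow_nonneg hΩ.le _)) hF1
      _ = F ^ ((1 : ℝ) / (2 * m)) := by rw [e2, one_mul]
  -- (5.17): assemble
  set Y : ℝ := (Ωp / Ω) ^ β with hYdef
  have hY0 : 0 ≤ Y := Real.rpow_nonneg (div_pos hΩp hΩ).le _
  have eY1 : Ωp ^ β * Ω ^ (1 - β) = Y * Ω := by
    rw [hYdef, Real.div_rpow hΩp.le hΩ.le, Real.rpow_sub hΩ, Real.rpow_one]
    field_simp
  have eY2 : Ωp ^ ((m : ℝ) + 1) * Ω ^ ((1 : ℝ) - m) = Y ^ θ * Ω * Ω := by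
    rw [hYdef, ← Real.rpow_mul (div_pos hΩp hΩ).le, hβθ, Real.div_rpow hΩp.le hΩ.le,
      Real.rpow_sub hΩ, Real.rpow_one, Real.rpow_natCast]
    have : Ω ^ ((m : ℝ) + 1) = Ω ^ (m : ℝ) * Ω := by rw [Real.rpow_add hΩ, Real.rpow_one]
    rw [this, Real.rpow_natCast]
    field_simp
  have h517 : R ≤ Ω * (-(ν * k₁' * Y) + k₅ * Y ^ θ * Ω + ν * k₆) + F ^ ((1 : ℝ) / (2 * m)) := by
    have e : R = cf * V := by rw [hReq, hcfdef]
    have h1 : cf * V ≤ cf * (-(ν * c₁ * J3) + ν * c₂ * J + c₃ * Real.sqrt J * Real.sqrt Jp +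
        2 * m * J ^ ((2 * (m : ℝ) - 1) / (2 * m)) * F ^ ((1 : ℝ) / (2 * m))) :=
      mul_le_mul_of_nonneg_left hVlad hcf0.le
    have e2 : cf * (-(ν * c₁ * J3) + ν * c₂ * J + c₃ * Real.sqrt J * Real.sqrt Jp +
        2 * m * J ^ ((2 * (m : ℝ) - 1) / (2 * m)) * F ^ ((1 : ℝ) / (2 * m))) =
        cf * -(ν * c₁ * J3) + cf * (ν * c₂ * J) + cf * (c₃ * Real.sqrt J * Real.sqrt Jp) +
          cf * (2 * m * J ^ ((2 * (m : ℝ) - 1) / (2 * m)) * F ^ ((1 : ℝ) / (2 * m))) := by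
      ring
    rw [e]
    refine h1.trans ?_
    rw [e2]
    have e3 : Ω * (-(ν * k₁' * Y) + k₅ * Y ^ θ * Ω + ν * k₆) + F ^ ((1 : ℝ) / (2 * m)) =
        (-(ν * k₁' * (Y * Ω)) + ν * (c₁ / (2 * m)) * Ω) + ν * (c₂ / (2 * m)) * Ω +
          k₅ * (Y ^ θ * Ω * Ω) + F ^ ((1 : ℝ) / (2 * m)) := by rw [hk₆]; ring
    rw [e3, ← eY1, ← eY2]
    exact add_le_add (add_le_add (add_le_add hB hC) hDst) hE
  -- (5.18): Young on the central term
  have hyoung := young hY0 hΩ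
  have e4 : (Ω / ν) ^ Q = (Ω / ν) ^ (2 * gibbonAlpha m) := by rw [hQα]
  rw [e4] at hyoung
  calc R ≤ Ω * (-(ν * k₁' * Y) + k₅ * Y ^ θ * Ω + ν * k₆) + F ^ ((1 : ℝ) / (2 * m)) := h517
    _ ≤ Ω * (-(ν * k₁' * Y) + (ν * k₁' / 2 * Y + k₂ * (ν * (Ω / ν) ^ (2 * gibbonAlpha m))) +
          ν * k₆) + F ^ ((1 : ℝ) / (2 * m)) := by
        gcongr
    _ = ν * Ω * (-(k₁' / 2 * Y) + k₂ * (Ω / ν) ^ (2 * gibbonAlpha m) + k₆) +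
          F ^ ((1 : ℝ) / (2 * m)) := by ring

open VorticityMomentLadder in
/-- **THEOREM 2, forced case** (Gibbon 2012, Thm 2: "In the forced case there is an additive term
`ϖ_{3,m}Gr Dₘ`"): along a classical solution of the FORCED system on `𝕋³ × [a, b]` (`ν > 0`), at
every instant at which the forcing slice `f t` is smooth, every one-sided derivative value `R` of
`s ↦ Dₘ(u(s))` within `[a, b]` satisfies
`R ≤ Dₘ³{−νc₁(D_{m+1}/Dₘ)^{ρₘ} + νc₂} + c₃ Dₘ (∫|curl f(t)|^{2m})^{1/2m}/ν`
— the printed additive term in the generic-forcing shape `αₘ Dₘ ‖curl f‖_{2m}/Ωₘ ≤ αₘDₘ‖curl f‖_{2m}/ν`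
(the print's `ϖ_{3,m}Gr Dₘ` packages `‖∇f‖_{2m}` into the Grashof number under its single-scale
forcing hypothesis (5.8), which is not typed). [cite: Gibbon2012JMP, Theorem 2 (forced case) with
§5 (5.15)–(5.20)] -/
theorem exists_gibbonD_ladder_forced (m : ℕ) (hm : 1 ≤ m) :
    ∃ c₁ c₂ c₃ : ℝ, 0 < c₁ ∧ 0 ≤ c₂ ∧ 0 ≤ c₃ ∧
      ∀ {a b ν : ℝ} {f u : ℝ → UnitAddTorus (Fin 3) → EuclideanSpace ℝ (Fin 3)}
        {p : ℝ → UnitAddTorus (Fin 3) → ℝ},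
        Torus.IsClassicalNSSolutionOn (Icc a b) ν f u p → a < b → 0 < ν →
        ∀ {t : ℝ}, t ∈ Icc a b → Torus.IsSmooth (f t) → ∀ {R : ℝ},
          HasDerivWithinAt (fun s => gibbonD ν m (u s)) R (Icc a b) t →
          R ≤ gibbonD ν m (u t) ^ 3 *
            (-(ν * c₁ * (gibbonD ν (m + 1) (u t) / gibbonD ν m (u t)) ^ gibbonRho m) + ν * c₂) +
            c₃ * gibbonD ν m (u t) * (∫ x, torusVorticitySqAt (f t) x ^ m) ^ ((1 : ℝ) / (2 * m)) / ν := by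
  obtain ⟨k₁, k₂, k₃, hk₁, hk₂, hk₃, hΩlad⟩ := exists_gibbonOmega_ladder_forced m hm
  have hα := gibbonAlpha_pos hm
  refine ⟨gibbonAlpha m * k₁, gibbonAlpha m * (k₂ + k₃), gibbonAlpha m, by positivity, by positivity,
    hα.le, ?_⟩
  intro a b ν f u p h hab hν t ht hft R hR
  set Ω : ℝ := gibbonOmega ν m (u t) with hΩdef
  set Ωp : ℝ := gibbonOmega ν (m + 1) (u t) with hΩpdef
  set D : ℝ := gibbonD ν m (u t) with hDdef
  set Dp : ℝ := gibbonD ν (m + 1) (u t) with hDpdef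
  have hΩ : 0 < Ω := gibbonOmega_pos hν hm (u t)
  have hD : 0 < D := gibbonD_pos hν hm (u t)
  have hD1 : 1 ≤ D := one_le_gibbonD hν hm (u t)
  have hνΩ : ν ≤ Ω := le_gibbonOmega hν hm (u t)
  set Fr : ℝ := (∫ x, torusVorticitySqAt (f t) x ^ m) ^ ((1 : ℝ) / (2 * m)) with hFrdef
  have hFr0 : 0 ≤ Fr := Real.rpow_nonneg (integral_pow_nonneg (f t) m) _
  -- the `Ω`-derivative and the chain rule for `D`
  have hJ' := h.hasDerivWithinAt_integral_torusVorticitySqAt_pow hab m ht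
  have hΩ' := hasDerivWithinAt_gibbonOmega hν hm hJ'
  set RΩ : ℝ := (1 : ℝ) / (2 * m) * gibbonOmega ν m (u t) ^ ((1 : ℝ) - 2 * m) *
    ((2 * m * (∫ x, torusVorticitySqAt (u t) x ^ (m - 1) * torusStretchingDensity (u t) x) -
        ν * (m * (∫ x, torusVorticitySqAt (u t) x ^ (m - 1) * ∑ k, ∑ i, ∑ j,
              Torus.partialDeriv k (torusVorticityTensor (u t) i j) x ^ 2) +
            m * (m - 1) * ∫ x, torusVorticitySqAt (u t) x ^ (m - 2) *
              ∑ k, Torus.partialDeriv k (torusVorticitySqAt (u t)) x ^ 2) +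
        m * ∫ x, torusVorticitySqAt (u t) x ^ (m - 1) * ∑ i, ∑ j, torusVorticityTensor (u t) i j x *
          (Torus.partialDeriv i (f t) x j - Torus.partialDeriv j (f t) x i)))
    with hRΩdef
  have hRΩ : RΩ ≤ ν * Ω * (-(k₁ * (Ωp / Ω) ^ (4 * (m : ℝ) * (m + 1) / 3)) +
      k₂ * (Ω / ν) ^ (2 * gibbonAlpha m) + k₃) + Fr := hΩlad h hab hν ht hft hΩ'
  have hD' := hasDerivWithinAt_gibbonD hν hm hΩ'
  have hU : UniqueDiffWithinAt ℝ (Icc a b) t := uniqueDiffOn_Icc hab t ht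
  have hReq : R = gibbonAlpha m * D / Ω * RΩ := (hR.derivWithin hU).symm.trans (hD'.derivWithin hU)
  -- substitute
  have hfac : 0 ≤ gibbonAlpha m * D / Ω := by positivity
  have hforce : gibbonAlpha m * D / Ω * Fr ≤ gibbonAlpha m * D * Fr / ν := by
    rw [div_mul_eq_mul_div]
    exact div_le_div_of_nonneg_left (by positivity) hν hνΩ
  have h1 : R ≤ gibbonAlpha m * D / Ω * (ν * Ω * (-(k₁ * (Ωp / Ω) ^ (4 * (m : ℝ) * (m + 1) / 3)) +
      k₂ * (Ω / ν) ^ (2 * gibbonAlpha m) + k₃)) + gibbonAlpha m * D * Fr / ν := by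
    rw [hReq]
    calc gibbonAlpha m * D / Ω * RΩ
        ≤ gibbonAlpha m * D / Ω * (ν * Ω * (-(k₁ * (Ωp / Ω) ^ (4 * (m : ℝ) * (m + 1) / 3)) +
            k₂ * (Ω / ν) ^ (2 * gibbonAlpha m) + k₃) + Fr) := mul_le_mul_of_nonneg_left hRΩ hfac
      _ = gibbonAlpha m * D / Ω * (ν * Ω * (-(k₁ * (Ωp / Ω) ^ (4 * (m : ℝ) * (m + 1) / 3)) +
            k₂ * (Ω / ν) ^ (2 * gibbonAlpha m) + k₃)) + gibbonAlpha m * D / Ω * Fr := mul_add _ _ _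
      _ ≤ _ := add_le_add le_rfl hforce
  have e2 : (Ω / ν) ^ (2 * gibbonAlpha m) = D ^ 2 := (gibbonD_sq hν hm (u t)).symm
  have e3 : (Ωp / Ω) ^ (4 * (m : ℝ) * (m + 1) / 3) = (Dp / D) ^ gibbonRho m * D ^ 2 :=
    gibbonOmega_ratio_rpow_eq hν hm (u t)
  rw [e2, e3] at h1
  have e4 : gibbonAlpha m * D / Ω * (ν * Ω * (-(k₁ * ((Dp / D) ^ gibbonRho m * D ^ 2)) +
      k₂ * D ^ 2 + k₃)) = ν * gibbonAlpha m * D * (-(k₁ * (Dp / D) ^ gibbonRho m * D ^ 2) +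
        k₂ * D ^ 2 + k₃) := by
    field_simp
  rw [e4] at h1
  -- `k₃ ≤ k₃ D²` since `D ≥ 1`
  have hk3 : k₃ ≤ k₃ * D ^ 2 := by
    have : 1 ≤ D ^ 2 := one_le_pow₀ hD1
    nlinarith
  have hY0 : 0 ≤ (Dp / D) ^ gibbonRho m :=
    Real.rpow_nonneg (div_pos (gibbonD_pos hν (by omega) (u t)) hD).le _
  calc R ≤ ν * gibbonAlpha m * D * (-(k₁ * (Dp / D) ^ gibbonRho m * D ^ 2) + k₂ * D ^ 2 + k₃) +
        gibbonAlpha m * D * Fr / ν := h1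
    _ ≤ ν * gibbonAlpha m * D * (-(k₁ * (Dp / D) ^ gibbonRho m * D ^ 2) + k₂ * D ^ 2 +
          k₃ * D ^ 2) + gibbonAlpha m * D * Fr / ν := by gcongr
    _ = D ^ 3 * (-(ν * (gibbonAlpha m * k₁) * (Dp / D) ^ gibbonRho m) +
          ν * (gibbonAlpha m * (k₂ + k₃))) + gibbonAlpha m * D * Fr / ν := by ring

end Literature.Analysis.FluidPDE
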